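import Mathlib

/-!
# B3♭-EXTISO — kernel companion (hsemireg-monad-4 g21; MECH pen + typing)

Bookkeeping shadows for memo `B3FLAT-EXTISO-monad4-g21.md` (THEOREM RC-E♯:
`H¹(Z(s), N_{Z(s)/X}) ≅ Ext²_X(𝓔,𝓔)` on the R-C road, via LEMMA KOS3 — a three-column twisted
Koszul resolution of `j̃_* N` on `P = ℙ(F)`, `F = A ⊕ 𝒪(−tH)` of rank `a+1`, `G = π^*K(1)` of
rank `a+4`).  What is checked here is ONLY the finite combinatorics / arithmetic the pen proof
leans on:

* (K1) the term grid of LEMMA KOS3: columns `c ∈ {−2,−1,0}` (encoded `Col`), Koszul degree `r`,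
  the weight `w = r + [c = −2]`, the four kinds of components of the differential and
  `kos3_weight_monotone` (no component raises the weight, so `F_w` is a subcomplex);
* (K2) the direct-image trichotomy on a `ℙ^a`-bundle (`π_*`-type iff twist `≥ 0`, gap iff
  `−a ≤ twist ≤ −1`, `R^a`-type iff twist `≤ −a−1`) and `kos3_pistar_iff_weight_le_one`:
  for `1 ≤ a`, `r ≤ a+4`, a term is `π_*`-type iff its weight is `≤ 1`;
* (K3) the `X`-degree `d = n − c + r − a` in which an `R^a`-type term `(c,r)` contributes to
  `ℍⁿ`, with `kos3_Ra_degree_le` (`d ≤ n + 6`), `kos3_Ra_degree_bound` (`n ≤ 1 ⇒ d ≤ 7`, the Serre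
  range) and `kos3_unique_top_term` (`d = n + 6` only at `(c,r) = (−2, a+4)`, the last
  Eagon–Northcott term);
* (K4) scalar bookkeeping: `h^{0,q}(X) = C(8,q)` (`1, 8, 28, 56`), `3136 = C(8,3)·C(8,5)`, and the
  budget predicate `RCBudget` recording the law `h¹(N) = ext²(𝓔,𝓔)`, `ext²(𝓜,𝓜) = ext²(𝓔,𝓔) + 28`
  with the necessary test `ext²(𝓔,𝓔) ≤ 3136` and the floor `28 ≤ ext²(𝓔,𝓔)`;
* (K5) `c4_twist_rank3` / `c4_twist_rank4`: the binomials behind «`c₄` of a virtual rank-3 class is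
  twist-invariant, of a rank-4 class is not» (scalar consistency of THEOREM RC-KB, memo v1.1 §4);
* (K5b) `corank_one_normal_rank`, `fitting_expected_codim`, `en_length_good_presentation`,
  `scalar_pencil_coeff(_virtual)`: THEOREM RC-KB bookkeeping (memo v1.1 §4).
* (K6) `betteWindow`: the `E₁`-window for `ext²(𝓔,𝓔)` from the bête sequence of `[A → K]`, as a
  SPEC (definition only).

Nothing in this file is a statement about HC, HC_CM, HC_AV, H2 = `BlochSeedDiscOne`,
stmt-18881 or stmt-26512; no census word; Mathlib only; no `sorry`, no `instance`, no `notation`.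
-/

set_option linter.dupNamespace false
set_option autoImplicit false

namespace Summit.HodgeConjecture.HodgeConjecture.Cruxes.BlochSeedDiscOne.ExtIso

/-! ## (K1) The term grid of LEMMA KOS3 and the weight filtration -/

/-- The three columns of (E3): `O` = the column `𝒪` (c = −2), `Fcol` = `π^*F(1)` (c = −1),
`Gcol` = `G` (c = 0). -/
inductive Col | O | Fcol | Gcol

/-- The integer column index `c ∈ {−2, −1, 0}`. -/
def Col.idx : Col → ℤ
  | .O => -2
  | .Fcol => -1
  | .Gcol => 0

/-- The relative twist `ε_c` of the column bundle: `𝒪 = 𝒪_P(0)`, `π^*F(1)`, `G = π^*K(1)`. -/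
def Col.eps : Col → ℤ
  | .O => 0
  | .Fcol => 1
  | .Gcol => 1

/-- Weight of the term `(c, r)`: `w = r + [c = −2]`. -/
def weight : Col → ℕ → ℕ
  | .O, r => r + 1
  | .Fcol, r => r
  | .Gcol, r => r

/-- Total degree of the term `(c, r)`: `c − r`. -/
def tdeg (c : Col) (r : ℕ) : ℤ := c.idx - r

/-- The four kinds of components of the twisted differential `d = ι_σ + u ⊗ 1 + v ⊗ 1 + h`. -/
inductive Kind | koszul | euler | phi | homotopy

/-- Source column admitted by each kind (`none` = any column, for `ι_σ`). -/
def Kind.src : Kind → Option Col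
  | .koszul => none
  | .euler => some Col.O
  | .phi => some Col.Fcol
  | .homotopy => some Col.O

/-- Target column of each kind, given the source column. -/
def Kind.tgt : Kind → Col → Col
  | .koszul, c => c
  | .euler, _ => Col.Fcol
  | .phi, _ => Col.Gcol
  | .homotopy, _ => Col.Gcol

/-- Change of Koszul degree: `ι_σ` lowers `r` by one, `h` raises it by one, `u, v` keep it.
Encoded as `r ↦ r + up − down`. -/
def Kind.up : Kind → ℕ
  | .homotopy => 1
  | _ => 0

def Kind.down : Kind → ℕ
  | .koszul => 1
  | _ => 0

/-- A component of kind `k` may start at column `c` (and, for `ι_σ`, needs `r ≥ 1`). -/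
def admissible (k : Kind) (c : Col) (r : ℕ) : Prop :=
  (k.src = none ∨ k.src = some c) ∧ k.down ≤ r

/-- Every component has total degree `+1`. -/
theorem kos3_degree_one (k : Kind) (c : Col) (r : ℕ) (h : admissible k c r) :
    tdeg (k.tgt c) (r + k.up - k.down) = tdeg c r + 1 := by
  rcases h with ⟨hs, hd⟩
  cases k <;> cases c <;> simp_all [Kind.src, Kind.tgt, Kind.up, Kind.down, tdeg, Col.idx] <;> omega

/-- LEMMA KOS3 §1.2: no component of `d` raises the weight (`Δw ∈ {0, −1}`), so each
`F_w = ⊕_{w(c,r) ≤ w} 𝓓^{(c,r)}` is a subcomplex. -/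
theorem kos3_weight_monotone (k : Kind) (c : Col) (r : ℕ) (h : admissible k c r) :
    weight (k.tgt c) (r + k.up - k.down) ≤ weight c r ∧
      weight c r ≤ weight (k.tgt c) (r + k.up - k.down) + 1 := by
  rcases h with ⟨hs, hd⟩
  cases k <;> cases c <;> simp_all [Kind.src, Kind.tgt, Kind.up, Kind.down, weight]

/-- The exact drops: `ι_σ` and the Euler unit `u` lower the weight by one; `v` and `h` keep it. -/
theorem kos3_weight_drop (c : Col) (r : ℕ) (hr : 1 ≤ r) :
    weight c (r - 1) + 1 = weight c r ∧ weight Col.Fcol r + 1 = weight Col.O r ∧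
      weight Col.Gcol r = weight Col.Fcol r ∧ weight Col.Gcol (r + 1) = weight Col.O r := by
  cases c <;> simp [weight] <;> omega

/-! ## (K2) Direct images on a `ℙ^a`-bundle -/

/-- The `𝒪_P`-twist of the term `(c, r)`: `ε_c − r`. -/
def twist (c : Col) (r : ℕ) : ℤ := c.eps - r

/-- `Rπ_* 𝒪_{ℙ^a-bundle}(m)`: `π_*`-type iff `m ≥ 0`. -/
def piStarType (m : ℤ) : Prop := 0 ≤ m
/-- gap: `Rπ_* 𝒪(m) = 0` iff `−a ≤ m ≤ −1`. -/
def gapType (a : ℕ) (m : ℤ) : Prop := -(a : ℤ) ≤ m ∧ m ≤ -1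
/-- `R^a`-type iff `m ≤ −a−1`; then `R^a π_* 𝒪(−a−1−k) = S^k F ⊗ det F` with `k = −m − a − 1`. -/
def RaType (a : ℕ) (m : ℤ) : Prop := m ≤ -(a : ℤ) - 1

theorem trichotomy (a : ℕ) (m : ℤ) : piStarType m ∨ gapType a m ∨ RaType a m := by
  unfold piStarType gapType RaType; omega

theorem trichotomy_disjoint (a : ℕ) (m : ℤ) :
    ¬ (piStarType m ∧ gapType a m) ∧ ¬ (piStarType m ∧ RaType a m) ∧
      ¬ (gapType a m ∧ RaType a m) := by
  unfold piStarType gapType RaType; omega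

/-- LEMMA KOS3 §1.3 (i): for `1 ≤ a` and `r ≤ a + 4` the `π_*`-type terms are EXACTLY the terms
of weight `≤ 1` — i.e. `F₁` = `{(−2,0), (−1,0), (−1,1), (0,0), (0,1)}`. -/
theorem kos3_pistar_iff_weight_le_one (a : ℕ) (c : Col) (r : ℕ) (_ha : 1 ≤ a) (_hr : r ≤ a + 4) :
    piStarType (twist c r) ↔ weight c r ≤ 1 := by
  cases c <;> simp [piStarType, twist, weight, Col.eps]

/-- The five `π_*`-type terms and their images `𝒪_X, 𝓔nd F, 𝓗om(K,F), 𝓗om(F,K), 𝓔nd K`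
(memo §1.4): listed as the solutions of `weight ≤ 1`. -/
theorem kos3_F1_terms (c : Col) (r : ℕ) :
    weight c r ≤ 1 ↔ (c = Col.O ∧ r = 0) ∨ (c = Col.Fcol ∧ r ≤ 1) ∨ (c = Col.Gcol ∧ r ≤ 1) := by
  cases c <;> simp [weight]

/-- Every `R^a`-type summand carries `𝒪(−m tH)` with `m = j + 1 ≥ 1` (`S^k F ⊗ det F =
⊕_j S^{k−j}A ⊗ det A ⊗ 𝒪(−(j+1)tH)`): the twist multiplicity is positive. -/
theorem kos3_serre_twist_pos (j : ℕ) : 1 ≤ j + 1 := by omega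

/-! ## (K3) The `X`-degree of an `R^a`-type contribution -/

/-- An `R^a`-type term `(c,r)` contributes to `ℍⁿ(P, 𝓓/F₁)` through `H^d(X, ·)` with
`d = n − c + r − a` (total degree `c − r`, and `H^q(P, π^*V(m)) = H^{q−a}(X, V ⊗ R^aπ_*𝒪(m))`). -/
def xdeg (n : ℤ) (c : Col) (r a : ℕ) : ℤ := n - c.idx + r - a

/-- `d ≤ n + 6` for every term with `r ≤ a + 4`. -/
theorem kos3_Ra_degree_le (n : ℤ) (c : Col) (r a : ℕ) (hr : r ≤ a + 4) :
    xdeg n c r a ≤ n + 6 := by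
  cases c <;> simp [xdeg, Col.idx] <;> omega

/-- LEMMA KOS3 §1.3 (ii): for `n ≤ 1` every `R^a`-type term lands in `X`-degree `d ≤ 7`, where
`H^d(X, V ⊗ 𝒪(−m tH)) = 0` (`m ≥ 1`, `t ≫ 0`) by Serre duality + vanishing on the 8-fold `X`. -/
theorem kos3_Ra_degree_bound (n : ℤ) (c : Col) (r a : ℕ) (hr : r ≤ a + 4) (hn : n ≤ 1) :
    xdeg n c r a ≤ 7 := by
  have := kos3_Ra_degree_le n c r a hr; omega

/-- … and the lower end: an `R^a`-type term has `d ≥ n + 2` (so negative `n` are harmless too). -/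
theorem kos3_Ra_degree_ge (n : ℤ) (c : Col) (r a : ℕ) (hRa : RaType a (twist c r)) :
    n + 2 ≤ xdeg n c r a := by
  cases c <;> simp_all [xdeg, Col.idx, RaType, twist, Col.eps] <;> omega

/-- LEMMA KOS3 §1.3: at `n = 2` the only term reaching `d = 8` is `(c,r) = (−2, a+4)` — the last
Eagon–Northcott term `Λ^{a+4}K^∨ ⊗ S³F ⊗ det F`, which feeds `H²(Z,N)` only (THEOREM RC-E♯ (c)). -/
theorem kos3_unique_top_term (n : ℤ) (c : Col) (r a : ℕ) (hr : r ≤ a + 4)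
    (hd : xdeg n c r a = n + 6) : c = Col.O ∧ r = a + 4 := by
  cases c <;> simp_all [xdeg, Col.idx] <;> omega

/-- The `R^a`-type terms sit in degrees `c − r + a ≤ −2` of `Rπ_*(𝓓/F₁)` (so `𝓗⁰(π_*F₁) ≅ j_*N`). -/
theorem kos3_Ra_sheaf_degree (c : Col) (r a : ℕ) (hRa : RaType a (twist c r)) :
    tdeg c r + a ≤ -2 := by
  cases c <;> simp_all [tdeg, Col.idx, RaType, twist, Col.eps] <;> omega

/-- Eagon–Northcott bookkeeping (memo §1.5): the column `c = −2` terms of `R^a`-type are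
`r = a + j`, `j = 1, …, 4`, with `k = r − a − 1 = j − 1` (`EN_j = Λ^{a+j}K^∨ ⊗ S^{j−1}F ⊗ det F`),
and the EN complex has length `4` = the codimension of `Z(s)`. -/
theorem en_terms (a r : ℕ) (hr : r ≤ a + 4) :
    RaType a (twist Col.O r) ↔ ∃ j, 1 ≤ j ∧ j ≤ 4 ∧ r = a + j := by
  simp only [RaType, twist, Col.eps]
  constructor
  · intro h; exact ⟨r - a, by omega, by omega, by omega⟩
  · rintro ⟨j, hj1, _, rfl⟩; push_cast; omega

/-! ## (K4) Scalar bookkeeping on the abelian 8-fold -/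

/-- `h^{0,q}(X) = C(8,q)` for `q = 0, 1, 2, 3`: the scalar classes `H^{0,q}·id`. -/
theorem hodge_h0q :
    Nat.choose 8 0 = 1 ∧ Nat.choose 8 1 = 8 ∧ Nat.choose 8 2 = 28 ∧ Nat.choose 8 3 = 56 := by
  decide

/-- `h^{3,5}(X) = C(8,3)·C(8,5) = 3136`, the target dimension of Bloch's map `π_Z`. -/
theorem budget_3136 : Nat.choose 8 3 * Nat.choose 8 5 = 3136 := by decide

/-- The trace splits the scalars: `tr(c·id_𝓜) = 3c` (virtual rank `(a+4) − (a+1) = 3 ≠ 0`)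
and `tr(c·id_𝓔) = 4c`. -/
theorem virtual_rank (a : ℕ) : (a + 4) - (a + 1) = 3 ∧ (3 : ℤ) ≠ 0 ∧ (4 : ℤ) ≠ 0 := by omega

/-- THEOREM RC-E♯ budget record for one display: the exact law `h¹(Z(s),N) = ext²(𝓔,𝓔)`,
`ext²(𝓜,𝓜) = ext²(𝓔,𝓔) + h^{0,2}`, the scalar floor and Bloch's necessary count. -/
structure RCBudget where
  ext2EE : ℕ
  ext2MM : ℕ
  h1N : ℕ
  law_h1N : h1N = ext2EE
  law_MM : ext2MM = ext2EE + 28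
  floor : 28 ≤ ext2EE

/-- (B3♭-dim, exact form): Bloch-semiregularity of `Z(s)` needs `π_Z` injective on `H¹(N)`,
so `h¹(N) ≤ 3136`. -/
def RCBudget.b3flatDim (B : RCBudget) : Prop := B.h1N ≤ 3136

theorem RCBudget.b3flatDim_iff (B : RCBudget) : B.b3flatDim ↔ B.ext2EE ≤ 3136 := by
  unfold RCBudget.b3flatDim; rw [B.law_h1N]

/-- g20's form `ext²(𝓜,𝓜) ≤ 3164` is the same test. -/
theorem RCBudget.b3flatDim_iff_MM (B : RCBudget) : B.b3flatDim ↔ B.ext2MM ≤ 3164 := by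
  rw [B.b3flatDim_iff, B.law_MM]; omega

/-- The window of crit rider R2 (`−8 ≤ ext²(𝓜,𝓜) − ext²(𝓔,𝓔) ≤ 28`) collapses to its upper end. -/
theorem RCBudget.r2_window (B : RCBudget) :
    (B.ext2EE : ℤ) - 8 ≤ B.ext2MM ∧ (B.ext2MM : ℤ) ≤ B.ext2EE + 28 ∧
      (B.ext2MM : ℤ) - B.ext2EE = 28 := by
  have := B.law_MM; omega

/-- At least `28` directions of `H¹(Z(s),N)` always exist (and must be separated by `π_Z`). -/
theorem RCBudget.h1N_floor (B : RCBudget) : 28 ≤ B.h1N := by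
  rw [B.law_h1N]; exact B.floor

/-! ## (K5) Twist (in)variance of `c₄`: scalar consistency of THEOREM RC-KB -/

/-- `c₄(V ⊗ L) = Σ_k C(rk V − k, 4 − k) c_k(V) l^{4−k}`; for virtual rank `3` every coefficient with
`k ≤ 3` vanishes, so `c₄(K − F)` is twist-invariant and `δc₄(K−F)` kills `H^{0,2}·id_𝓜`. -/
theorem c4_twist_rank3 : ∀ k ≤ 3, Nat.choose (3 - k) (4 - k) = 0 := by decide

/-- … while for the rank-4 sheaf `𝓔` the coefficients are `1`: scalars of `Ext²(𝓔,𝓔)` DO move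
`[Z(s)] = c₄(𝓔(tH))` (linear term `c₃(𝓔(tH))`). -/
theorem c4_twist_rank4 : ∀ k ≤ 4, Nat.choose (4 - k) (4 - k) = 1 := by decide

/-- `[Z(s)] = c₄(K − F) = c₄(𝓔(tH))`: the expansion coefficients `C(4−k, 4−k) = 1` give
`Σ_k c_k(𝓔) (tH)^{4−k}`. (Same binomials.) -/
theorem class_expansion (k : ℕ) (hk : k ≤ 4) : Nat.choose (4 - k) (4 - k) = 1 :=
  c4_twist_rank4 k hk

/-! ## (K5b) THEOREM RC-KB bookkeeping (memo v1.1 §4) -/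

/-- §4.2 (b)(c): for the good presentation `F' → K' = 𝒪(-mH)^r ↠ 𝓜` (rank `F' = r - 3`), a corank-one
map `ℂ^{r-3} → ℂ^r` has kernel of dimension `1` and cokernel of dimension `r - (r - 3 - 1) = 4`, so the
normal bundle `Hom(ker, coker)` of the corank-one stratum has rank `1 * 4 = 4 = codim Z(s)`. -/
theorem corank_one_normal_rank (r : ℕ) (hr : 4 ≤ r) : 1 * (r - (r - 3 - 1)) = 4 := by omega

/-- §4.2 (b): the Fitting index — `Fitt₃(𝓜)` is generated by the `(r - 3)`-minors of `φ' : F' → K'`,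
i.e. by its MAXIMAL minors (`rank F' = r - 3 ≤ r = rank K'`), and `D_{(r-3)-1}(φ')` has expected
codimension `((r-3) - (r-4)) * (r - (r-4)) = 4`. -/
theorem fitting_expected_codim (r : ℕ) (hr : 4 ≤ r) : ((r - 3) - (r - 4)) * (r - (r - 4)) = 4 := by
  have h1 : (r - 3) - (r - 4) = 1 := by omega
  have h2 : r - (r - 4) = 4 := by omega
  rw [h1, h2]

/-- §4.2 (c): the Eagon–Northcott complex of `φ' : F' → K'` (ranks `r - 3 ≤ r`) has length
`r - (r - 3) + 1 = 4` (terms `EN_1 … EN_4` after `EN_0 = 𝒪`), matching `en_terms` for the display. -/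
theorem en_length_good_presentation (r : ℕ) (hr : 4 ≤ r) : r - (r - 3) + 1 = 4 := by omega

/-- §4.1 / §4.3 (ii): the SCALAR PENCIL. For the rank-4 sheaf `𝓔`, `d/dλ c_k(𝓔 ⊗ L_λ)|₀ = C(4-k+1, 1)·c_{k-1}`
`= (5 - k)·c_{k-1}`, so `δc₄(𝓔(tH))(c·id) = c ∪ (4t³H³ + 3t²H²c₁ + 2tH·c₂ + c₃)`: coefficients `4,3,2,1`. -/
theorem scalar_pencil_coeff : ∀ k, 1 ≤ k → k ≤ 4 → Nat.choose (4 - k + 1) 1 = 5 - k := by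
  intro k h1 h4
  interval_cases k <;> decide

/-- … whereas for the virtual rank-3 class `[𝓜] = [𝓔] - [𝒪(-tH)]` the same derivative is
`C(4-k, 1)·c_{k-1} = (4-k)·c_{k-1}` for `1 ≤ k ≤ 4` (zero at `k = 4`), and the TOTAL scalar derivative of `c₄([𝓜])`, i.e. the
`λ`-derivative of `c₄([𝓜] ⊗ L_λ) = Σ_k C(3-k, 4-k) c_k λ^{4-k}`, vanishes (`c4_twist_rank3`): `e₂` and
`δc₄(𝓜)` both kill `H^{0,2}·id_𝓜` (memo §4.1 consistency; machine split-model check `code/en_ch_identity.py`). -/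
theorem scalar_pencil_coeff_virtual : ∀ k, 1 ≤ k → k ≤ 4 → Nat.choose (4 - k) 1 = 4 - k := by
  intro k h1 h4
  interval_cases k <;> decide

/-! ## (K6) The bête `E₁`-window for `ext²(𝓔,𝓔)` (SPEC) -/

/-- Letter-computable dimensions entering the `E₁` page of the column spectral sequence of
`R𝓗om([A → K],[A → K])` in total degree `2` and its neighbours. -/
structure BetteE1 where
  e3KA : ℕ  -- ext³(K,A), column −1
  e2KA : ℕ  -- ext²(K,A)
  e2AA : ℕ  -- ext²(A,A), column 0
  e2KK : ℕ  -- ext²(K,K)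
  e2AK : ℕ  -- ext²(A,K), column 1 (receives d₁ from degree-2 column 0)
  e1AK : ℕ  -- ext¹(A,K), column 1

/-- SPEC (memo §5.2): the `E₁`-window `e²(A,A) + e²(K,K) − e²(A,K) − e²(K,A) ≤ ext²(𝓔,𝓔) ≤
e³(K,A) + e²(A,A) + e²(K,K) + e¹(A,K)`.  A definition, not a theorem: the inequalities follow from
finite-dimensional linear algebra on the spectral sequence and are recorded here as the shape of
the (blind) letter test. -/
def betteWindow (E : BetteE1) (ext2EE : ℕ) : Prop :=
  E.e2AA + E.e2KK ≤ ext2EE + E.e2AK + E.e2KA ∧ ext2EE ≤ E.e3KA + E.e2AA + E.e2KK + E.e1AK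

/-- The window is BLIND for the budget test as soon as its upper end exceeds `3136` while its lower
end does not: both verdicts are then consistent with the letters. -/
def betteBlind (E : BetteE1) : Prop :=
  E.e2AA + E.e2KK < 3137 + E.e2AK + E.e2KA ∧ 3136 < E.e3KA + E.e2AA + E.e2KK + E.e1AK

theorem betteBlind_iff (E : BetteE1) :
    betteBlind E ↔ (∃ n, betteWindow E n ∧ n ≤ 3136) ∧ (∃ n, betteWindow E n ∧ 3136 < n) := by
  unfold betteBlind betteWindow
  constructor
  · rintro ⟨h1, h2⟩
    refine ⟨⟨min 3136 (E.e3KA + E.e2AA + E.e2KK + E.e1AK), ?_, ?_⟩,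
      ⟨E.e3KA + E.e2AA + E.e2KK + E.e1AK, ?_, h2⟩⟩ <;> omega
  · rintro ⟨⟨n, ⟨h1, h2⟩, h3⟩, ⟨m, ⟨h4, h5⟩, h6⟩⟩; omega

end Summit.HodgeConjecture.HodgeConjecture.Cruxes.BlochSeedDiscOne.ExtIso
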